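import Summits.FinalStateConjecture.FinalStateConjecture.Theorems.RobustClausewiseGenericityCensorshipRobustSplit
import Summits.FinalStateConjecture.FinalStateConjecture.Theorems.RobustClausewiseGenericityCensorshipRobustCrossInterpolant
import HarnessLib

/-!
# Crux `CensorshipRobust` (stmt-FinalStateConjecture-10131) · line `walls-and-superposition` · the composition with
# `stub_crossInterpolant` discharged: `CensorshipRobust ⇐ censoredIsProbeOpen ∧ nakedThresholdWalls ∧ crossProjection`

The crux-strategist's registered skeleton `Cruxes/CensorshipRobust/Lines/walls_and_superposition.lean` composes the crux
`Theses.RobustClausewiseGenericity.CensorshipRobust` from FOUR stubs: the two pieces of the typed decomposition from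
their stubs (`censorshipWalls_of_stubs`: case split censored / naked; `tameAxisSuperposition_of_stubs`: plateau squash of
a projected cross interpolant) followed by the split glue `censorshipRobust_of_subs` (landed, p160192). With the cross
interpolant `stub_crossInterpolant` landed (p161592) this file records, in the permanent tree, the composition with that
stub discharged: `censorshipRobust_of_three` — the crux BY NAME from the statements of the three remaining registered
stubs `stub_censoredIsProbeOpen` (stability of censorship along tame probes at censored data), `stub_nakedThresholdWalls`
(threshold walls at naked-singularity data) and `stub_crossProjection` (constraint projection with parameters keeping
admissible members; Corvino–Schoen / Chruściel–Delay content, KID caveat), each quoted verbatim as a hypothesis.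
The proofs of `censorshipWalls_of_stubs` and of the plateau squash are the strategist's, verbatim up to the discharge.

No `def`s, no named facts; standard axioms.
-/

noncomputable section

namespace Summit.FinalStateConjecture.FinalStateConjecture.Theorems.RobustClausewiseGenericity

open Literature.Geometry.Lorentzian
open Set Function Filter Metric
open scoped Manifold ContDiff Topology

-- D-0017: single-problem summit, `Summit.<S>.<S>.…` by design.
set_option linter.dupNamespace false

/-- **`CensorshipWalls` from its two stubs** (case split on whether `d` is censored; `J = 0` at censored data); the
conclusion is VERBATIM the split child `CensorshipWalls`; crux-strategist's proof. [folklore] -/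
theorem censorshipWalls_of_stubs :
    (∀ (X : Type) [TopologicalSpace X] [ChartedSpace E3 X] [IsManifold (𝓡 3) ∞ X] [T2Space X]
      [SecondCountableTopology X] [ConnectedSpace X], ∀ d ∈ admissibleVacuumData X,
      (∀ 𝒟 : VacuumCauchyDevelopment d, 𝒟.IsMaximal →
        Summit.FinalStateConjecture.HasCompleteNullInfinity 𝒟.toCauchyDevelopment) →
      ∀ (m : ℕ) (G : EuclideanSpace ℝ (Fin m) → InitialDataSet (𝓡 3) X), Tame d m G →
        ∃ δ : ℝ, 0 < δ ∧ ∀ c, ‖c‖ < δ →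
          ∀ 𝒟 : VacuumCauchyDevelopment (G c), 𝒟.IsMaximal →
            Summit.FinalStateConjecture.HasCompleteNullInfinity 𝒟.toCauchyDevelopment) →
    (∀ (X : Type) [TopologicalSpace X] [ChartedSpace E3 X] [IsManifold (𝓡 3) ∞ X] [T2Space X]
      [SecondCountableTopology X] [ConnectedSpace X], ∀ d ∈ admissibleVacuumData X,
      (¬ ∀ 𝒟 : VacuumCauchyDevelopment d, 𝒟.IsMaximal →
        Summit.FinalStateConjecture.HasCompleteNullInfinity 𝒟.toCauchyDevelopment) →
      ∃ (J : ℕ) (Λ : Fin J → InitialDataSet (𝓡 3) X → ℝ),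
        (∀ (m : ℕ) (G : EuclideanSpace ℝ (Fin m) → InitialDataSet (𝓡 3) X), Tame d m G →
          ∀ j, DifferentiableAt ℝ (Λ j ∘ G) 0) ∧
        (∀ j, ∃ γ : EuclideanSpace ℝ (Fin 1) → InitialDataSet (𝓡 3) X, Tame d 1 γ ∧ fderiv ℝ (Λ j ∘ γ) 0 ≠ 0) ∧
        ∀ (m : ℕ) (G : EuclideanSpace ℝ (Fin m) → InitialDataSet (𝓡 3) X), Tame d m G →
          ∃ δ : ℝ, 0 < δ ∧ ∀ c, ‖c‖ < δ → (∀ j, Λ j (G c) ≠ Λ j d) →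
            ∀ 𝒟 : VacuumCauchyDevelopment (G c), 𝒟.IsMaximal →
              Summit.FinalStateConjecture.HasCompleteNullInfinity 𝒟.toCauchyDevelopment) →
    (∀ (X : Type) [TopologicalSpace X] [ChartedSpace Literature.Geometry.Lorentzian.E3 X] [IsManifold (𝓡 3) ((⊤ : ℕ∞) : WithTop ℕ∞) X] [T2Space X] [SecondCountableTopology X] [ConnectedSpace X], ∀ d ∈ Literature.Geometry.Lorentzian.admissibleVacuumData X, let Tame : (m : ℕ) → (EuclideanSpace ℝ (Fin m) → Literature.Geometry.Lorentzian.InitialDataSet (𝓡 3) X) → Prop := fun m G ↦ Literature.Geometry.Lorentzian.InitialDataSet.IsSmoothDataFamily m G ∧ G 0 = d ∧ (∀ c, G c ∈ Literature.Geometry.Lorentzian.admissibleVacuumData X) ∧ ∃ K : Set X, IsCompact K ∧ ∀ c, ∀ x ∉ K, (G c).h.inner x = d.h.inner x ∧ (G c).k x = d.k x; let Q : Literature.Geometry.Lorentzian.InitialDataSet (𝓡 3) X → Prop := fun D ↦ ∀ 𝒟 : Literature.Geometry.Lorentzian.VacuumCauchyDevelopment D, 𝒟.IsMaximal → Summit.FinalStateConjecture.HasCompleteNullInfinity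 𝒟.toCauchyDevelopment; ∃ (J : ℕ) (Λ : Fin J → Literature.Geometry.Lorentzian.InitialDataSet (𝓡 3) X → ℝ), (∀ (m : ℕ) (G : EuclideanSpace ℝ (Fin m) → Literature.Geometry.Lorentzian.InitialDataSet (𝓡 3) X), Tame m G → ∀ j, DifferentiableAt ℝ (Λ j ∘ G) 0) ∧ (∀ j, ∃ γ : EuclideanSpace ℝ (Fin 1) → Literature.Geometry.Lorentzian.InitialDataSet (𝓡 3) X, Tame 1 γ ∧ fderiv ℝ (Λ j ∘ γ) 0 ≠ 0) ∧ ∀ (m : ℕ) (G : EuclideanSpace ℝ (Fin m) → Literature.Geometry.Lorentzian.InitialDataSet (𝓡 3) X), Tame m G → ∃ δ : ℝ, 0 < δ ∧ ∀ c, ‖c‖ < δ → (∀ j, Λ j (G c) ≠ Λ j d) → Q (G c)) := by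
  intro hopen hwalls X _ _ _ _ _ _ d hd
  dsimp only
  by_cases hQ : ∀ 𝒟 : VacuumCauchyDevelopment d, 𝒟.IsMaximal →
      Summit.FinalStateConjecture.HasCompleteNullInfinity 𝒟.toCauchyDevelopment
  · -- censored base datum: no wall, (ii) = probe-openness
    refine ⟨0, fun j => j.elim0, fun m G hG j => j.elim0, fun j => j.elim0, fun m G hG => ?_⟩
    obtain ⟨δ, hδ, h⟩ := hopen X d hd hQ m G hG
    exact ⟨δ, hδ, fun c hc _ => h c hc⟩
  · -- naked-singularity base datum: the threshold walls
    exact hwalls X d hd hQ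

/-- **`TameAxisSuperposition` from `stub_crossProjection` alone** (the cross interpolant `stub_crossInterpolant` is
landed, p161592): plateau squash of the projected cross interpolant — the crux-strategist's composition
`tameAxisSuperposition_of_stubs` of `Cruxes/CensorshipRobust/Lines/walls_and_superposition.lean` with its first
hypothesis discharged. The conclusion is VERBATIM the split child `TameAxisSuperposition`. [folklore] -/
theorem tameAxisSuperposition_of_crossProjection :
    (∀ (X : Type) [TopologicalSpace X] [ChartedSpace E3 X] [IsManifold (𝓡 3) ∞ X] [T2Space X]
      [SecondCountableTopology X] [ConnectedSpace X], ∀ d ∈ admissibleVacuumData X,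
      ∀ (N : ℕ) (P : EuclideanSpace ℝ (Fin N) → InitialDataSet (𝓡 3) X) (π : EuclideanSpace ℝ (Fin N) →L[ℝ] ℝ)
        (R : ℝ), InitialDataSet.IsSmoothDataFamily N P →
        (∃ K : Set X, IsCompact K ∧ ∀ q, ∀ x ∉ K, (P q).h.inner x = d.h.inner x ∧ (P q).k x = d.k x) →
        (∀ q, π q = 0 → P q ∈ admissibleVacuumData X) →
        (∀ q, R ≤ ‖q‖ → P q ∈ admissibleVacuumData X) →
        ∃ (P' : EuclideanSpace ℝ (Fin N) → InitialDataSet (𝓡 3) X) (ε : ℝ), 0 < ε ∧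
          InitialDataSet.IsSmoothDataFamily N P' ∧
          (∃ K : Set X, IsCompact K ∧ ∀ q, ∀ x ∉ K, (P' q).h.inner x = d.h.inner x ∧ (P' q).k x = d.k x) ∧
          (∀ q, P q ∈ admissibleVacuumData X → P' q = P q) ∧
          ∀ q, |π q| < ε → P' q ∈ admissibleVacuumData X) →
    (∀ (X : Type) [TopologicalSpace X] [ChartedSpace Literature.Geometry.Lorentzian.E3 X] [IsManifold (𝓡 3) ((⊤ : ℕ∞) : WithTop ℕ∞) X] [T2Space X] [SecondCountableTopology X] [ConnectedSpace X], ∀ d ∈ Literature.Geometry.Lorentzian.admissibleVacuumData X, let Tame : (m : ℕ) → (EuclideanSpace ℝ (Fin m) → Literature.Geometry.Lorentzian.InitialDataSet (𝓡 3) X) → Prop := fun m G ↦ Literature.Geometry.Lorentzian.InitialDataSet.IsSmoothDataFamily m G ∧ G 0 = d ∧ (∀ c, G c ∈ Literature.Geometry.Lorentzian.admissibleVacuumData X) ∧ ∃ K : Set X, IsCompact K ∧ ∀ c, ∀ x ∉ K, (G c).h.inner x = d.h.inner x ∧ (G c).k x = d.k x; ∀ (m : ℕ) (G : EuclideanSpace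 ℝ (Fin m) → Literature.Geometry.Lorentzian.InitialDataSet (𝓡 3) X) (γ : EuclideanSpace ℝ (Fin 1) → Literature.Geometry.Lorentzian.InitialDataSet (𝓡 3) X), Tame m G → Tame 1 γ → ∃ (n : ℕ) (G₁ : EuclideanSpace ℝ (Fin n) → Literature.Geometry.Lorentzian.InitialDataSet (𝓡 3) X) (L : EuclideanSpace ℝ (Fin m) →ₗ[ℝ] EuclideanSpace ℝ (Fin n)) (L₁ : EuclideanSpace ℝ (Fin 1) →ₗ[ℝ] EuclideanSpace ℝ (Fin n)), Function.Injective L ∧ Tame n G₁ ∧ (∀ c, G₁ (L c) = G c) ∧ ∃ ε : ℝ, 0 < ε ∧ ∀ s, ‖s‖ < ε → G₁ (L₁ s) = γ s) := by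
  intro hP X _ _ _ _ _ _ d hd
  dsimp only
  intro m G γ hG hγ
  obtain ⟨P, L, L₁, π, ε₀, R, hL, hπL, hπL₁, hε₀, hPs, hPK, hPG, hPγ, hP0, hPR⟩ :=
    stub_crossInterpolant X d hd m G γ hG hγ
  obtain ⟨P', ε, hε, hP's, ⟨K', hK', hP'K⟩, hP'P, hP'adm⟩ := hP X d hd (m + 1) P π R hPs hPK hP0 hPR
  -- the plateau squash `σ t = t · b t`
  obtain ⟨ε₁, hε₁pos, hε₁ε, hε₁ε₀⟩ : ∃ ε₁ : ℝ, 0 < ε₁ ∧ 4 * ε₁ ≤ ε ∧ 2 * ε₁ ≤ ε₀ :=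
    ⟨min (ε / 4) (ε₀ / 2), lt_min (by positivity) (by positivity),
      by linarith [min_le_left (ε / 4) (ε₀ / 2)], by linarith [min_le_right (ε / 4) (ε₀ / 2)]⟩
  let b : ContDiffBump (0 : ℝ) := ⟨ε₁, 2 * ε₁, hε₁pos, by linarith⟩
  let σ : ℝ → ℝ := fun t => t * b t
  have hσs : ContDiff ℝ ∞ σ := contDiff_id.mul b.contDiff
  have hσid : ∀ t : ℝ, |t| ≤ ε₁ → σ t = t := fun t ht => by
    show t * b t = t
    rw [b.one_of_mem_closedBall (by rw [Metric.mem_closedBall, Real.dist_eq, sub_zero]; exact ht), mul_one]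
  have hσlt : ∀ t : ℝ, |σ t| < ε := fun t => by
    show |t * b t| < ε
    by_cases ht : 2 * ε₁ ≤ |t|
    · rw [b.zero_of_le_dist (by rw [Real.dist_eq, sub_zero]; exact ht), mul_zero, abs_zero]
      exact hε
    · push Not at ht
      calc |t * b t| = |t| * b t := by rw [abs_mul, abs_of_nonneg b.nonneg]
        _ ≤ |t| * 1 := mul_le_mul_of_nonneg_left b.le_one (abs_nonneg t)
        _ < ε := by linarith
  -- the reparametrisation `Ψ q = q + (σ (π q) - π q) • e`
  let e : EuclideanSpace ℝ (Fin (m + 1)) := L₁ (EuclideanSpace.single 0 1)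
  have hπe : π e = 1 := by
    show π (L₁ (EuclideanSpace.single 0 1)) = 1
    rw [hπL₁]
    simp
  let Ψ : EuclideanSpace ℝ (Fin (m + 1)) → EuclideanSpace ℝ (Fin (m + 1)) :=
    fun q => q + (σ (π q) - π q) • e
  have hΨs : ContDiff ℝ ∞ Ψ :=
    contDiff_id.add (((hσs.comp π.contDiff).sub π.contDiff).smul contDiff_const)
  have hπΨ : ∀ q, π (Ψ q) = σ (π q) := fun q => by
    show π (q + (σ (π q) - π q) • e) = σ (π q)
    rw [map_add, map_smul, hπe, smul_eq_mul, mul_one]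
    ring
  have hΨfix : ∀ q, |π q| ≤ ε₁ → Ψ q = q := fun q hq => by
    show q + (σ (π q) - π q) • e = q
    rw [hσid _ hq, sub_self, zero_smul, add_zero]
  refine ⟨m + 1, fun q => P' (Ψ q), L, L₁, hL,
    ⟨hP's.comp_contDiff hΨs, ?_, fun q => hP'adm _ ?_, K', hK', fun q x hx => hP'K _ x hx⟩,
    fun c => ?_, ε₁, hε₁pos, fun s hs => ?_⟩
  · -- base point: `Ψ 0 = 0`, `P' 0 = P 0 = G 0 = d`
    show P' (Ψ 0) = d
    have hΨ0 : Ψ 0 = 0 := hΨfix 0 (by rw [map_zero, abs_zero]; exact hε₁pos.le)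
    have hPG0 : P 0 = G 0 := by simpa using hPG 0
    rw [hΨ0, hP'P 0 (hP0 0 (map_zero π)), hPG0, hG.2.1]
  · -- admissibility everywhere: `|π (Ψ q)| = |σ (π q)| < ε`
    rw [hπΨ]
    exact hσlt _
  · -- the enrichment survives: `Ψ (L c) = L c`, `P' (L c) = P (L c) = G c`
    show P' (Ψ (L c)) = G c
    rw [hΨfix (L c) (by rw [hπL c, abs_zero]; exact hε₁pos.le), hP'P _ (hP0 _ (hπL c)), hPG]
  · -- the local axis survives: `‖s‖ < ε₁ ⇒ Ψ (L₁ s) = L₁ s`, `P' (L₁ s) = P (L₁ s) = γ s`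
    show P' (Ψ (L₁ s)) = γ s
    have hs0 : |s 0| ≤ ε₁ := by
      have h := PiLp.norm_apply_le s 0
      rw [Real.norm_eq_abs] at h
      exact h.trans hs.le
    have hsε₀ : ‖s‖ < ε₀ := by linarith
    have hPγs : P (L₁ s) = γ s := hPγ s hsε₀
    rw [hΨfix (L₁ s) (by rw [hπL₁]; exact hs0), hP'P _ (by rw [hPγs]; exact hγ.2.2.1 s), hPγs]

/-- **`censorshipRobust_of_three`** — the crux `CensorshipRobust` BY NAME from the statements of the three remaining
registered stubs of line `walls-and-superposition` (`stub_censoredIsProbeOpen`, `stub_nakedThresholdWalls`,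
`stub_crossProjection`, verbatim as hypotheses), the fourth (`stub_crossInterpolant`) being landed: pieces from stubs,
then the landed split glue `censorshipRobust_of_subs`. [folklore] -/
theorem censorshipRobust_of_three :
    (∀ (X : Type) [TopologicalSpace X] [ChartedSpace E3 X] [IsManifold (𝓡 3) ∞ X] [T2Space X]
        [SecondCountableTopology X] [ConnectedSpace X], ∀ d ∈ admissibleVacuumData X,
        (∀ 𝒟 : VacuumCauchyDevelopment d, 𝒟.IsMaximal →
          Summit.FinalStateConjecture.HasCompleteNullInfinity 𝒟.toCauchyDevelopment) →
        ∀ (m : ℕ) (G : EuclideanSpace ℝ (Fin m) → InitialDataSet (𝓡 3) X), Tame d m G →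
          ∃ δ : ℝ, 0 < δ ∧ ∀ c, ‖c‖ < δ →
            ∀ 𝒟 : VacuumCauchyDevelopment (G c), 𝒟.IsMaximal →
              Summit.FinalStateConjecture.HasCompleteNullInfinity 𝒟.toCauchyDevelopment) →
    (∀ (X : Type) [TopologicalSpace X] [ChartedSpace E3 X] [IsManifold (𝓡 3) ∞ X] [T2Space X]
        [SecondCountableTopology X] [ConnectedSpace X], ∀ d ∈ admissibleVacuumData X,
        (¬ ∀ 𝒟 : VacuumCauchyDevelopment d, 𝒟.IsMaximal →
          Summit.FinalStateConjecture.HasCompleteNullInfinity 𝒟.toCauchyDevelopment) →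
        ∃ (J : ℕ) (Λ : Fin J → InitialDataSet (𝓡 3) X → ℝ),
          (∀ (m : ℕ) (G : EuclideanSpace ℝ (Fin m) → InitialDataSet (𝓡 3) X), Tame d m G →
            ∀ j, DifferentiableAt ℝ (Λ j ∘ G) 0) ∧
          (∀ j, ∃ γ : EuclideanSpace ℝ (Fin 1) → InitialDataSet (𝓡 3) X, Tame d 1 γ ∧ fderiv ℝ (Λ j ∘ γ) 0 ≠ 0) ∧
          ∀ (m : ℕ) (G : EuclideanSpace ℝ (Fin m) → InitialDataSet (𝓡 3) X), Tame d m G →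
            ∃ δ : ℝ, 0 < δ ∧ ∀ c, ‖c‖ < δ → (∀ j, Λ j (G c) ≠ Λ j d) →
              ∀ 𝒟 : VacuumCauchyDevelopment (G c), 𝒟.IsMaximal →
                Summit.FinalStateConjecture.HasCompleteNullInfinity 𝒟.toCauchyDevelopment) →
    (∀ (X : Type) [TopologicalSpace X] [ChartedSpace E3 X] [IsManifold (𝓡 3) ∞ X] [T2Space X]
        [SecondCountableTopology X] [ConnectedSpace X], ∀ d ∈ admissibleVacuumData X,
        ∀ (N : ℕ) (P : EuclideanSpace ℝ (Fin N) → InitialDataSet (𝓡 3) X) (π : EuclideanSpace ℝ (Fin N) →L[ℝ] ℝ)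
          (R : ℝ), InitialDataSet.IsSmoothDataFamily N P →
          (∃ K : Set X, IsCompact K ∧ ∀ q, ∀ x ∉ K, (P q).h.inner x = d.h.inner x ∧ (P q).k x = d.k x) →
          (∀ q, π q = 0 → P q ∈ admissibleVacuumData X) →
          (∀ q, R ≤ ‖q‖ → P q ∈ admissibleVacuumData X) →
          ∃ (P' : EuclideanSpace ℝ (Fin N) → InitialDataSet (𝓡 3) X) (ε : ℝ), 0 < ε ∧
            InitialDataSet.IsSmoothDataFamily N P' ∧
            (∃ K : Set X, IsCompact K ∧ ∀ q, ∀ x ∉ K, (P' q).h.inner x = d.h.inner x ∧ (P' q).k x = d.k x) ∧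
            (∀ q, P q ∈ admissibleVacuumData X → P' q = P q) ∧
            ∀ q, |π q| < ε → P' q ∈ admissibleVacuumData X) →
    Theses.RobustClausewiseGenericity.CensorshipRobust :=
  fun hO hW hP ↦ censorshipRobust_of_subs (censorshipWalls_of_stubs hO hW)
    (tameAxisSuperposition_of_crossProjection hP)

end Summit.FinalStateConjecture.FinalStateConjecture.Theorems.RobustClausewiseGenericity

end
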